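import Literature.Computability.Complexity.ShenRefereeRounds
import Literature.Computability.Complexity.CodeFPListKit
import HarnessLib

/-!
# The `IP = PSPACE` referee, machine layer III: the verdict on a history in polynomial time

Continuation of `ShenRefereeRounds.lean`. Arthur's verdict `ShenRef.natAccepts q β d ψ h` on a complete
history of the Shamir–Shen game (`ShenRefereeSpec.lean`; Arora–Barak §8.3.3) — pair the moves after
Arthur's opening move, run the `T` rounds, apply the final check `P_φ(v) = c` — is computed on codes:

* `ShenRef.alt` / `altStep` — the moves at even and at odd positions, by one alternating scan each
  (`foldl_altStep`, the accumulator a sublist of the input), and `pairsOf_eq_zip_alt`: the move pairs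
  are their `zip`; `pairsOfC`;
* `ShenRef.qbfE` (the code `PrenexQBF.encode` as a typed encoder), `quantsC`, `matrixC`;
* **`ShenRef.natAcceptsC`**: `((q, 1^β, 1^d), ψ, h) ↦ natAccepts (max q 2) β d ψ h`.

All proved; no named facts.

## References

* S. Arora, B. Barak, *Computational Complexity: A Modern Approach*, CUP 2009, §8.3.3, §1.3.
-/

noncomputable section

namespace Literature.Computability.Complexity

open _root_.Computability Polynomial Brick CodeFP Literature.Barriers.QuantumAdvantage

namespace ShenRef

/-! ### Pairing the moves -/

/-- The items at even (`true`) or odd (`false`) positions. [folklore] -/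
def alt {α : Type} : Bool → List α → List α
  | _, [] => []
  | true, a :: l => a :: alt false l
  | false, _ :: l => alt true l

/-- **The move pairs are the zip of the even and the odd moves.** [folklore] -/
theorem pairsOf_eq_zip_alt {α : Type} : ∀ l : List α, ShenGame.pairsOf l = (alt true l).zip (alt false l)
  | [] => rfl
  | [_] => rfl
  | a :: b :: l => by
    simp only [ShenGame.pairsOf, alt, List.zip_cons_cons, pairsOf_eq_zip_alt l]

/-- `alt` yields a sublist. [folklore] -/
theorem alt_sublist {α : Type} : ∀ (b : Bool) (l : List α), (alt b l).Sublist l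
  | _, [] => by cases ‹Bool› <;> exact List.Sublist.slnil
  | true, a :: l => (alt_sublist false l).cons_cons a
  | false, a :: l => (alt_sublist true l).cons a

/-- One step of the alternating scan: flip the flag, keep the item when the flag was set. [folklore] -/
def altStep {α : Type} (x : α) (st : Bool × List α) : Bool × List α :=
  (!st.1, if st.1 then st.2 ++ [x] else st.2)

/-- The flag after scanning `l` from flag `b`. [folklore] -/
def altFlag {α : Type} : Bool → List α → Bool
  | b, [] => b
  | b, _ :: l => altFlag (!b) l

/-- **The alternating scan computes `alt`.** [folklore] -/
theorem foldl_altStep {α : Type} : ∀ (l : List α) (b : Bool) (acc : List α),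
    l.foldl (fun st x => altStep x st) (b, acc) = (altFlag b l, acc ++ alt b l)
  | [], b, acc => by cases b <;> simp [altFlag, alt]
  | x :: l, b, acc => by
    rw [List.foldl_cons, show altStep x (b, acc) = (!b, if b then acc ++ [x] else acc) from rfl, foldl_altStep l]
    cases b <;> simp [altFlag, alt]

/-- **`alt` on codes** (raw lists of strings). [cite: AroraBarakCC2009, §1.3] -/
theorem altC (b : Bool) : CodeFP (rawE strE) (rawE strE) (alt b) := by
  have hx : CodeFP (pairE strE (pairE bitE (rawE strE))) strE (fun t => t.1) := fst _ _
  have hb : CodeFP (pairE strE (pairE bitE (rawE strE))) bitE (fun t => t.2.1) := (snd _ _).fst'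
  have hacc : CodeFP (pairE strE (pairE bitE (rawE strE))) (rawE strE) (fun t => t.2.2) := (snd _ _).snd'
  have happ : CodeFP (pairE strE (pairE bitE (rawE strE))) (rawE strE) (fun t => t.2.2 ++ [t.1]) :=
    ((rawAppend strE).comp (hacc.pair ((rawSingleton strE).comp hx)) :)
  have hstep : CodeFP (pairE strE (pairE bitE (rawE strE))) (pairE bitE (rawE strE))
      (fun t => altStep t.1 t.2) := (hb.not.pair (hb.ite happ hacc) :)
  have hfold := foldl₀ (α := List Bool) (β := Bool × List (List Bool)) (eα := strE) (eβ := pairE bitE (rawE strE))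
    (step := fun x st => altStep x st) (b₀ := (b, [])) hstep (X + 5) (fun l₁ l₂ => by
      rw [foldl_altStep, List.nil_append, pairE_apply, length_boolPair]
      simp only [bitE, List.length_singleton, eval_add, eval_X, eval_ofNat]
      have h1 := length_rawE_le_of_sublist strE ((alt_sublist b l₁).trans (List.sublist_append_left l₁ l₂))
      omega)
  exact (hfold.snd'.congr fun l => by rw [foldl_altStep, List.nil_append] :)

/-- **The move pairs on codes**: `h ↦ pairsOf h`. [cite: AroraBarakCC2009, §1.3] -/
theorem pairsOfC : CodeFP (rawE strE) (rawE (pairE strE strE)) ShenGame.pairsOf :=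
  (((rawZip strE strE).comp ((altC true).pair (altC false))).congr fun l => (pairsOf_eq_zip_alt l).symm :)

/-! ### The code of a prenex formula as a typed encoder -/

/-- The code of a prenex formula (`PrenexQBF.encode`: prefix, then the formula code). [folklore] -/
def qbfE : PrenexQBF → List Bool := fun ψ => ψ.encode

/-- `qbfE ψ = ⟨quants, pfE matrix⟩`. [folklore] -/
theorem qbfE_apply (ψ : PrenexQBF) : qbfE ψ = boolPair ψ.quants (pfE ψ.matrix) := rfl

/-- The prefix, on codes. [folklore] -/
theorem quantsC : CodeFP qbfE strE PrenexQBF.quants := of_fn fstF fstF_mem_FP fun ψ => by rw [qbfE_apply, fstF_boolPair]; rfl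

/-- The matrix, on codes. [folklore] -/
theorem matrixC : CodeFP qbfE pfE PrenexQBF.matrix := of_fn sndF sndF_mem_FP fun ψ => by rw [qbfE_apply, sndF_boolPair]

/-! ### The verdict on codes -/

/-- The tuple handed to the verdict: parameters `(q, β, d)`, formula, history. [folklore] -/
abbrev VT : Type := (ℕ × ℕ × ℕ) × PrenexQBF × List (List Bool)

/-- Code of the verdict tuple (`β`, `d` unary). [folklore] -/
abbrev vtE : VT → List Bool := pairE (pairE natE (pairE unE unE)) (pairE qbfE (rawE strE))

/-- The raw modulus. [folklore] -/
theorem vtQraw : CodeFP vtE natE (fun t : VT => t.1.1) := (fst _ _).fst'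
/-- The block width. [folklore] -/
theorem vtBeta : CodeFP vtE unE (fun t : VT => t.1.2.1) := (fst _ _).snd'.fst'
/-- The degree bound. [folklore] -/
theorem vtD : CodeFP vtE unE (fun t : VT => t.1.2.2) := (fst _ _).snd'.snd'
/-- The prefix. [folklore] -/
theorem vtQuants : CodeFP vtE strE (fun t : VT => t.2.1.quants) := (quantsC.comp (snd _ _).fst' :)
/-- The matrix. [folklore] -/
theorem vtMatrix : CodeFP vtE pfE (fun t : VT => t.2.1.matrix) := (matrixC.comp (snd _ _).fst' :)
/-- The move pairs after Arthur's opening move. [folklore] -/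
theorem vtPairs : CodeFP vtE (rawE (pairE strE strE)) (fun t : VT => ShenGame.pairsOf (t.2.2.drop 1)) := by
  have h : CodeFP vtE (rawE strE) (fun t : VT => t.2.2.tail) := ((rawTail strE).comp (snd _ _).snd' :)
  exact ((pairsOfC.comp h).congr fun t => by rw [← List.drop_one] :)
/-- The number of rounds. [folklore] -/
theorem vtT : CodeFP vtE natE (fun t : VT => t.2.1.quants.length * (t.2.1.quants.length + 1) + t.2.1.quants.length) := by
  have hN : CodeFP vtE natE (fun t : VT => t.2.1.quants.length) := (strNatLength.comp vtQuants :)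
  have hN1 : CodeFP vtE natE (fun t : VT => t.2.1.quants.length + 1) := (natAdd.comp (hN.pair (const _ 1)) :)
  have hM : CodeFP vtE natE (fun t : VT => t.2.1.quants.length * (t.2.1.quants.length + 1)) := (natMul.comp (hN.pair hN1) :)
  exact (natAdd.comp (hM.pair hN) :)

/-- The state after the rounds, on codes. [folklore] -/
theorem vtState : CodeFP vtE stE (fun t : VT =>
    ((ShenGame.pairsOf (t.2.2.drop 1)).take (t.2.1.quants.length * (t.2.1.quants.length + 1) + t.2.1.quants.length)).foldl
      (natRoundStep (max t.1.1 2) t.1.2.1 t.1.2.2 t.2.1.quants) (natInit t.2.1.quants.length)) := by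
  have hctx : CodeFP vtE rctxE (fun t : VT => (t.1.1, t.2.1.quants, t.1.2.1, t.1.2.2)) :=
    (vtQraw.pair (vtQuants.pair (vtBeta.pair vtD)) :)
  have hprs : CodeFP vtE (rawE (pairE strE strE)) (fun t : VT =>
      (ShenGame.pairsOf (t.2.2.drop 1)).take (t.2.1.quants.length * (t.2.1.quants.length + 1) + t.2.1.quants.length)) :=
    ((rawTakeNat (pairE strE strE)).comp (vtT.pair vtPairs) :)
  exact ((roundsC.comp (hctx.pair hprs)).congr fun t => rfl :)

/-- **Arthur's verdict on codes**: `((q, 1^β, 1^d), ψ, h) ↦ natAccepts (max q 2) β d ψ h`.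
[cite: AroraBarakCC2009, §8.3.3 (the verifier runs in polynomial time)] -/
theorem natAcceptsC : CodeFP vtE bitE (fun t : VT => natAccepts (max t.1.1 2) t.1.2.1 t.1.2.2 t.2.1 t.2.2) := by
  have hlen : CodeFP vtE natE (fun t : VT => (ShenGame.pairsOf (t.2.2.drop 1)).length) :=
    ((natLength (pairE strE strE)).comp vtPairs :)
  have hcond : CodeFP vtE bitE (fun t : VT =>
      decide (t.2.1.quants.length * (t.2.1.quants.length + 1) + t.2.1.quants.length ≤ (ShenGame.pairsOf (t.2.2.drop 1)).length)) :=
    (natLe.comp (vtT.pair hlen) :)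
  have hvals : CodeFP vtE (rawE natE) (fun t : VT =>
      (((ShenGame.pairsOf (t.2.2.drop 1)).take (t.2.1.quants.length * (t.2.1.quants.length + 1) + t.2.1.quants.length)).foldl
        (natRoundStep (max t.1.1 2) t.1.2.1 t.1.2.2 t.2.1.quants) (natInit t.2.1.quants.length)).2.1) := vtState.snd'.fst'
  have hval : CodeFP vtE natE (fun t : VT => natVal (max t.1.1 2)
      (((ShenGame.pairsOf (t.2.2.drop 1)).take (t.2.1.quants.length * (t.2.1.quants.length + 1) + t.2.1.quants.length)).foldl
        (natRoundStep (max t.1.1 2) t.1.2.1 t.1.2.2 t.2.1.quants) (natInit t.2.1.quants.length)).2.1 t.2.1.matrix) :=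
    (natValC.comp ((vtQraw.pair hvals).pair vtMatrix) :)
  have hfin : CodeFP vtE bitE (fun t : VT => natFinal (max t.1.1 2) t.2.1.matrix
      (((ShenGame.pairsOf (t.2.2.drop 1)).take (t.2.1.quants.length * (t.2.1.quants.length + 1) + t.2.1.quants.length)).foldl
        (natRoundStep (max t.1.1 2) t.1.2.1 t.1.2.2 t.2.1.quants) (natInit t.2.1.quants.length))) :=
    (vtState.snd'.snd'.snd'.and ((beq natE_injective).comp (hval.pair vtState.snd'.snd'.fst')) :)
  exact ((hcond.and hfin).congr fun t => rfl :)

end ShenRef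

end Literature.Computability.Complexity

end
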